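import Summits.BirchSwinnertonDyer.BirchSwinnertonDyer.Theorems.AdditiveKolyvaginRoadSelmerRankOnePinnedOfPrimitive
import Summits.BirchSwinnertonDyer.BirchSwinnertonDyer.Theorems.AdditiveKolyvaginRoadKolyvaginPrimitiveAdditiveParityOfLevelInputs
import HarnessLib

/-!
# Route `AdditiveKolyvaginRoad`, crux r2 `KolyvaginPrimitiveAdditive` (KPA′, stmt-BirchSwinnertonDyer-21400):
# THE RANK SPLIT OF LINE `birth` v11 BY NAME — `KPA′ ⟸ P ∧ R1 ∧ R3` input-free, and `PUB → CT → (KPA′ ↔ P ∧ R1 ∧ R3)`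

Lead prover `bsd-wall-akr-p1` g8 (cell `pub/bsd-wall`); `--supports stmt-BirchSwinnertonDyer-21400` (helper). The registered skeleton
`Cruxes/KolyvaginPrimitiveAdditive/Lines/birth.lean` v11 (stub texts sha16 38fc181d27801020) composes the crux from three stubs inside the
(non-importable) `Cruxes` tree; this file states the same composition at `Theorems` level, with the three stub TEXTS as displayed hypotheses,
so that the route pen and other seats can cite the decomposition BY NAME — and adds its converse modulo the published inputs.

* `kolyvaginPrimitiveAdditive_of_rankSplit : «P» → «R1» → «R3» → KolyvaginPrimitiveAdditive` — INPUT-FREE (the bottom door + the parity case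
  split on `#Sel_p(E/K) = p^s`: at `s = 1` R1 produces a conductor-1 datum with `c₁(1) ≠ 0`, at `s` odd `≥ 3` R3 gives the conclusion).
* `rankSplit_of_kolyvaginPrimitiveAdditive_of_published : PUB → (∀ K, casselsTate_levelInputs K) → KolyvaginPrimitiveAdditive → «P» ∧ «R1» ∧ «R3»`
  — P by akr-p1 g4's `oddSelmerRankAdditive_of_levelInputs` (p557719: Gross–Zagier, Kolyvagin, modularity, levelwise Cassels–Tate), R1 by
  `selmerRankOnePinned_of_kolyvaginPrimitiveAdditive_of_published` (p645208: + McCallum's certificate half), R3 by restriction.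
* `kolyvaginPrimitiveAdditive_iff_rankSplit_of_published` — the two together: modulo PUB and the levelwise Cassels–Tate inputs, the crux IS the
  conjunction of the three registered stubs. (Here «P», «R1», «R3» abbreviate the stub texts, written out in full below; no `def`.)

HONEST FRAMING: glue ∕ bookkeeping; no `sorry`, no definition, standard axioms; the `iff` is CONDITIONAL on named published facts with no
`_holds` in the tree. Closes nothing: R1 and R3 are Kolyvagin's conjecture mod `p` at an additive prime (OPEN in print at `p² ∣ N`), P is
Gross–Zagier–Kolyvagin parity. BSD is not proved by any of this.

References: [cite: WZhang2014, Thm. 1.2, Thm. 9.1, Thm. 9.2, §9] [cite: GrossLMS1991, §4] [cite: McCallumLMS1991, §5 Cor. 5.6].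
-/

set_option linter.dupNamespace false
set_option autoImplicit false

noncomputable section

open scoped Classical

namespace Summit.BirchSwinnertonDyer.BirchSwinnertonDyer.Theorems.AdditiveKoly

open WeierstrassCurve NumberField IsDedekindDomain Field
  Literature.NumberTheory.EllipticCurves Literature.NumberTheory.EllipticCurves.ModularForms
  Literature.NumberTheory.EllipticCurves.Rank1Residual Literature.NumberTheory.GaloisRepresentations
  Summit.BirchSwinnertonDyer.Rank1Residual
  Summit.BirchSwinnertonDyer.BirchSwinnertonDyer.Theses.AdditiveKolyvaginRoad

/-- An odd natural number is `1` or at least `3`. [folklore] -/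
theorem eq_one_or_three_le_of_odd' {s : ℕ} (hs : Odd s) : s = 1 ∨ 3 ≤ s := by
  obtain ⟨k, rfl⟩ := hs
  rcases k with _ | k
  · exact Or.inl rfl
  · exact Or.inr (by omega)

/-- **KPA′ FROM THE RANK SPLIT, input-free** (the composition `KolyvaginPrimitiveAdditive_of` of skeleton `birth` v11, at `Theorems` level):
granted the TEXTS of the three registered stubs — P (`#Sel_p(E/K) = p^s`, `s` odd), R1 (at `#Sel_p(E/K) = p` some conductor-1 datum has
`c₁(1) ≠ 0`), R3 (at `#Sel_p = p^s`, `s` odd `≥ 3`, all `c₁(1) = 0` ⟹ some `c₁(n) ≠ 0` of Kolyvagin-prime support) — the crux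
`KolyvaginPrimitiveAdditive` holds: at a frame, either some conductor-1 datum has `c₁(1) ≠ 0` (witness `n = 1`, `KolyvaginDescent.kolSupp_one`),
or the parity case split applies. NO named fact. [cite: WZhang2014, §9 (Thm. 9.1)] [cite: GrossLMS1991, §4 (P_1 = y_K)] -/
theorem kolyvaginPrimitiveAdditive_of_rankSplit
    (hP : ∀ (W : WeierstrassCurve ℚ) [W.IsElliptic] [W.IsGloballyMinimal] [NeZero (W.conductorNorm ℤ)]
      (p : ℕ) [Fact p.Prime] (K : Type) [Field K] [NumberField K]
      (Dt : ModularParametrizationData W (W.conductorNorm ℤ)) (β : ℤ) (ι : K →+* ℂ),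
      5 ≤ p → Addv W p → W.HasSurjectiveModNGaloisRep p →
      (∀ (ℓ : ℕ) [Fact ℓ.Prime], W.HasMultiplicativeReductionAtPrime ℓ →
        ¬ p ∣ padicValInt ℓ W.minimalDiscriminantInt) →
      (∃ (ℓ₁ ℓ₂ : ℕ) (_ : Fact ℓ₁.Prime) (_ : Fact ℓ₂.Prime), ℓ₁ ≠ ℓ₂ ∧
        W.HasMultiplicativeReductionAtPrime ℓ₁ ∧ W.HasMultiplicativeReductionAtPrime ℓ₂) →
      ¬ p ∣ W.tamagawaProduct → W.analyticRank = 1 →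
      IsImaginaryQuadratic K → Odd (NumberField.discr K) →
      SatisfiesHeegnerHypothesis (W.conductorNorm ℤ) K →
      (W.quadraticTwist (NumberField.discr K : ℚ)).entireLFunction 1 ≠ 0 →
      (4 * (W.conductorNorm ℤ : ℤ)) ∣ β ^ 2 - NumberField.discr K → ¬ (p : ℤ) ∣ Dt.c →
      ∃ s : ℕ, Odd s ∧ Nat.card (WeierstrassCurve.selmerGroup (W.baseChange K) (p : ℤ)) = p ^ s)
    (hR1 : ∀ (W : WeierstrassCurve ℚ) [W.IsElliptic] [W.IsGloballyMinimal] [NeZero (W.conductorNorm ℤ)]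
      (p : ℕ) [Fact p.Prime] (K : Type) [Field K] [NumberField K]
      (Dt : ModularParametrizationData W (W.conductorNorm ℤ)) (β : ℤ) (ι : K →+* ℂ),
      5 ≤ p → Addv W p → W.HasSurjectiveModNGaloisRep p →
      (∀ (ℓ : ℕ) [Fact ℓ.Prime], W.HasMultiplicativeReductionAtPrime ℓ →
        ¬ p ∣ padicValInt ℓ W.minimalDiscriminantInt) →
      (∃ (ℓ₁ ℓ₂ : ℕ) (_ : Fact ℓ₁.Prime) (_ : Fact ℓ₂.Prime), ℓ₁ ≠ ℓ₂ ∧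
        W.HasMultiplicativeReductionAtPrime ℓ₁ ∧ W.HasMultiplicativeReductionAtPrime ℓ₂) →
      ¬ p ∣ W.tamagawaProduct → W.analyticRank = 1 →
      IsImaginaryQuadratic K → Odd (NumberField.discr K) → NumberField.discr K < -4 →
      SatisfiesHeegnerHypothesis (W.conductorNorm ℤ) K →
      (W.quadraticTwist (NumberField.discr K : ℚ)).entireLFunction 1 ≠ 0 →
      (4 * (W.conductorNorm ℤ : ℤ)) ∣ β ^ 2 - NumberField.discr K → ¬ (p : ℤ) ∣ Dt.c →
      Nat.card (WeierstrassCurve.selmerGroup (W.baseChange K) (p : ℤ)) = p →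
      ∃ d₁ : KolyvaginHeegnerData Dt β ι 1, d₁.kolyvaginClass (Fact.out : p.Prime) 1 ≠ 0)
    (hR3 : ∀ (W : WeierstrassCurve ℚ) [W.IsElliptic] [W.IsGloballyMinimal] [NeZero (W.conductorNorm ℤ)]
      (p : ℕ) [Fact p.Prime] (K : Type) [Field K] [NumberField K]
      (Dt : ModularParametrizationData W (W.conductorNorm ℤ)) (β : ℤ) (ι : K →+* ℂ),
      5 ≤ p → Addv W p → W.HasSurjectiveModNGaloisRep p →
      (∀ (ℓ : ℕ) [Fact ℓ.Prime], W.HasMultiplicativeReductionAtPrime ℓ →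
        ¬ p ∣ padicValInt ℓ W.minimalDiscriminantInt) →
      (∃ (ℓ₁ ℓ₂ : ℕ) (_ : Fact ℓ₁.Prime) (_ : Fact ℓ₂.Prime), ℓ₁ ≠ ℓ₂ ∧
        W.HasMultiplicativeReductionAtPrime ℓ₁ ∧ W.HasMultiplicativeReductionAtPrime ℓ₂) →
      ¬ p ∣ W.tamagawaProduct → W.analyticRank = 1 →
      IsImaginaryQuadratic K → Odd (NumberField.discr K) → NumberField.discr K < -4 →
      SatisfiesHeegnerHypothesis (W.conductorNorm ℤ) K →
      (W.quadraticTwist (NumberField.discr K : ℚ)).entireLFunction 1 ≠ 0 →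
      (4 * (W.conductorNorm ℤ : ℤ)) ∣ β ^ 2 - NumberField.discr K → ¬ (p : ℤ) ∣ Dt.c →
      ∀ s : ℕ, Odd s → 3 ≤ s →
      Nat.card (WeierstrassCurve.selmerGroup (W.baseChange K) (p : ℤ)) = p ^ s →
      (∀ d₁ : KolyvaginHeegnerData Dt β ι 1, d₁.kolyvaginClass (Fact.out : p.Prime) 1 = 0) →
      ∃ (n : ℕ) (d : KolyvaginHeegnerData Dt β ι n),
        KolyvaginDescent.KolSupp (Zhang2014.IsKolyvaginPrime (W.conductorNorm ℤ) W K p) n ∧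
          d.kolyvaginClass (Fact.out : p.Prime) 1 ≠ 0) :
    KolyvaginPrimitiveAdditive := by
  intro W _ _ _ p _ K _ _ Dt β ι h5 hadd hsurj hsp1 hsp2 htam hr1 hK hodd hd hHH hL hβ hc
  by_cases hbot : ∃ d₁ : KolyvaginHeegnerData Dt β ι 1, d₁.kolyvaginClass (Fact.out : p.Prime) 1 ≠ 0
  · obtain ⟨d₁, hd₁⟩ := hbot
    exact ⟨1, d₁, KolyvaginDescent.kolSupp_one _, hd₁⟩
  · push Not at hbot
    obtain ⟨s, hsodd, hs⟩ := hP W p K Dt β ι h5 hadd hsurj hsp1 hsp2 htam hr1 hK hodd hHH hL hβ hc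
    rcases eq_one_or_three_le_of_odd' hsodd with h1 | h3
    · subst h1
      rw [pow_one] at hs
      obtain ⟨d₁, hd₁⟩ := hR1 W p K Dt β ι h5 hadd hsurj hsp1 hsp2 htam hr1 hK hodd hd hHH hL hβ hc hs
      exact ⟨1, d₁, KolyvaginDescent.kolSupp_one _, hd₁⟩
    · exact hR3 W p K Dt β ι h5 hadd hsurj hsp1 hsp2 htam hr1 hK hodd hd hHH hL hβ hc s hsodd h3 hs hbot

/-- **THE RANK SPLIT FROM KPA′, modulo the published inputs** — the three stub texts of skeleton `birth` v11 follow from the crux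
`KolyvaginPrimitiveAdditive` granted `PublishedInputsAdditiveKoly` (item 20137: Gross–Zagier, Kolyvagin, modularity, McCallum's certificate
half are used) and the levelwise Cassels–Tate inputs (conjunct 1 of `PublishedDualityInputsAdditiveKoly`, item 21333; used by P only): P by
`oddSelmerRankAdditive_of_levelInputs` (p557719), R1 by `selmerRankOnePinned_of_kolyvaginPrimitiveAdditive_of_published` (p645208), R3 by
restriction. CONDITIONAL; closes nothing. [cite: WZhang2014, Thm. 9.2, Thm. 1.2] [cite: McCallumLMS1991, §5 Cor. 5.6] -/
theorem rankSplit_of_kolyvaginPrimitiveAdditive_of_published (hPub : PublishedInputsAdditiveKoly)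
    (hCT : ∀ (K : Type) [Field K] [NumberField K], casselsTate_levelInputs K) (hKPA : KolyvaginPrimitiveAdditive) :
    (∀ (W : WeierstrassCurve ℚ) [W.IsElliptic] [W.IsGloballyMinimal] [NeZero (W.conductorNorm ℤ)]
      (p : ℕ) [Fact p.Prime] (K : Type) [Field K] [NumberField K]
      (Dt : ModularParametrizationData W (W.conductorNorm ℤ)) (β : ℤ) (ι : K →+* ℂ),
      5 ≤ p → Addv W p → W.HasSurjectiveModNGaloisRep p →
      (∀ (ℓ : ℕ) [Fact ℓ.Prime], W.HasMultiplicativeReductionAtPrime ℓ →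
        ¬ p ∣ padicValInt ℓ W.minimalDiscriminantInt) →
      (∃ (ℓ₁ ℓ₂ : ℕ) (_ : Fact ℓ₁.Prime) (_ : Fact ℓ₂.Prime), ℓ₁ ≠ ℓ₂ ∧
        W.HasMultiplicativeReductionAtPrime ℓ₁ ∧ W.HasMultiplicativeReductionAtPrime ℓ₂) →
      ¬ p ∣ W.tamagawaProduct → W.analyticRank = 1 →
      IsImaginaryQuadratic K → Odd (NumberField.discr K) →
      SatisfiesHeegnerHypothesis (W.conductorNorm ℤ) K →
      (W.quadraticTwist (NumberField.discr K : ℚ)).entireLFunction 1 ≠ 0 →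
      (4 * (W.conductorNorm ℤ : ℤ)) ∣ β ^ 2 - NumberField.discr K → ¬ (p : ℤ) ∣ Dt.c →
      ∃ s : ℕ, Odd s ∧ Nat.card (WeierstrassCurve.selmerGroup (W.baseChange K) (p : ℤ)) = p ^ s) ∧
    (∀ (W : WeierstrassCurve ℚ) [W.IsElliptic] [W.IsGloballyMinimal] [NeZero (W.conductorNorm ℤ)]
      (p : ℕ) [Fact p.Prime] (K : Type) [Field K] [NumberField K]
      (Dt : ModularParametrizationData W (W.conductorNorm ℤ)) (β : ℤ) (ι : K →+* ℂ),
      5 ≤ p → Addv W p → W.HasSurjectiveModNGaloisRep p →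
      (∀ (ℓ : ℕ) [Fact ℓ.Prime], W.HasMultiplicativeReductionAtPrime ℓ →
        ¬ p ∣ padicValInt ℓ W.minimalDiscriminantInt) →
      (∃ (ℓ₁ ℓ₂ : ℕ) (_ : Fact ℓ₁.Prime) (_ : Fact ℓ₂.Prime), ℓ₁ ≠ ℓ₂ ∧
        W.HasMultiplicativeReductionAtPrime ℓ₁ ∧ W.HasMultiplicativeReductionAtPrime ℓ₂) →
      ¬ p ∣ W.tamagawaProduct → W.analyticRank = 1 →
      IsImaginaryQuadratic K → Odd (NumberField.discr K) → NumberField.discr K < -4 →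
      SatisfiesHeegnerHypothesis (W.conductorNorm ℤ) K →
      (W.quadraticTwist (NumberField.discr K : ℚ)).entireLFunction 1 ≠ 0 →
      (4 * (W.conductorNorm ℤ : ℤ)) ∣ β ^ 2 - NumberField.discr K → ¬ (p : ℤ) ∣ Dt.c →
      Nat.card (WeierstrassCurve.selmerGroup (W.baseChange K) (p : ℤ)) = p →
      ∃ d₁ : KolyvaginHeegnerData Dt β ι 1, d₁.kolyvaginClass (Fact.out : p.Prime) 1 ≠ 0) ∧
    (∀ (W : WeierstrassCurve ℚ) [W.IsElliptic] [W.IsGloballyMinimal] [NeZero (W.conductorNorm ℤ)]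
      (p : ℕ) [Fact p.Prime] (K : Type) [Field K] [NumberField K]
      (Dt : ModularParametrizationData W (W.conductorNorm ℤ)) (β : ℤ) (ι : K →+* ℂ),
      5 ≤ p → Addv W p → W.HasSurjectiveModNGaloisRep p →
      (∀ (ℓ : ℕ) [Fact ℓ.Prime], W.HasMultiplicativeReductionAtPrime ℓ →
        ¬ p ∣ padicValInt ℓ W.minimalDiscriminantInt) →
      (∃ (ℓ₁ ℓ₂ : ℕ) (_ : Fact ℓ₁.Prime) (_ : Fact ℓ₂.Prime), ℓ₁ ≠ ℓ₂ ∧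
        W.HasMultiplicativeReductionAtPrime ℓ₁ ∧ W.HasMultiplicativeReductionAtPrime ℓ₂) →
      ¬ p ∣ W.tamagawaProduct → W.analyticRank = 1 →
      IsImaginaryQuadratic K → Odd (NumberField.discr K) → NumberField.discr K < -4 →
      SatisfiesHeegnerHypothesis (W.conductorNorm ℤ) K →
      (W.quadraticTwist (NumberField.discr K : ℚ)).entireLFunction 1 ≠ 0 →
      (4 * (W.conductorNorm ℤ : ℤ)) ∣ β ^ 2 - NumberField.discr K → ¬ (p : ℤ) ∣ Dt.c →
      ∀ s : ℕ, Odd s → 3 ≤ s →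
      Nat.card (WeierstrassCurve.selmerGroup (W.baseChange K) (p : ℤ)) = p ^ s →
      (∀ d₁ : KolyvaginHeegnerData Dt β ι 1, d₁.kolyvaginClass (Fact.out : p.Prime) 1 = 0) →
      ∃ (n : ℕ) (d : KolyvaginHeegnerData Dt β ι n),
        KolyvaginDescent.KolSupp (Zhang2014.IsKolyvaginPrime (W.conductorNorm ℤ) W K p) n ∧
          d.kolyvaginClass (Fact.out : p.Prime) 1 ≠ 0) := by
  have hPub' := hPub
  obtain ⟨hGZ, hKo, -, -, hmod, -⟩ := hPub'
  refine ⟨oddSelmerRankAdditive_of_levelInputs hGZ hKo hmod hCT,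
    selmerRankOnePinned_of_kolyvaginPrimitiveAdditive_of_published hPub hKPA, ?_⟩
  intro W _ _ _ p _ K _ _ Dt β ι h5 hadd hsurj hsp1 hsp2 htam hr1 hK hodd hd hHH hL hβ hc _ _ _ _ _
  exact hKPA W p K Dt β ι h5 hadd hsurj hsp1 hsp2 htam hr1 hK hodd hd hHH hL hβ hc

/-- **MODULO THE PUBLISHED INPUTS, KPA′ IS EXACTLY THE CONJUNCTION OF THE THREE REGISTERED STUBS OF LINE `birth` v11** (P ∧ R1 ∧ R3):
`⇐` is input-free (`kolyvaginPrimitiveAdditive_of_rankSplit`), `⇒` uses Gross–Zagier, Kolyvagin, modularity, McCallum's certificate half (PUB)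
and the levelwise Cassels–Tate inputs. CONDITIONAL; closes nothing; BSD is not proved. [cite: WZhang2014, §9] -/
theorem kolyvaginPrimitiveAdditive_iff_rankSplit_of_published (hPub : PublishedInputsAdditiveKoly)
    (hCT : ∀ (K : Type) [Field K] [NumberField K], casselsTate_levelInputs K) :
    KolyvaginPrimitiveAdditive ↔
    ((∀ (W : WeierstrassCurve ℚ) [W.IsElliptic] [W.IsGloballyMinimal] [NeZero (W.conductorNorm ℤ)]
      (p : ℕ) [Fact p.Prime] (K : Type) [Field K] [NumberField K]
      (Dt : ModularParametrizationData W (W.conductorNorm ℤ)) (β : ℤ) (ι : K →+* ℂ),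
      5 ≤ p → Addv W p → W.HasSurjectiveModNGaloisRep p →
      (∀ (ℓ : ℕ) [Fact ℓ.Prime], W.HasMultiplicativeReductionAtPrime ℓ →
        ¬ p ∣ padicValInt ℓ W.minimalDiscriminantInt) →
      (∃ (ℓ₁ ℓ₂ : ℕ) (_ : Fact ℓ₁.Prime) (_ : Fact ℓ₂.Prime), ℓ₁ ≠ ℓ₂ ∧
        W.HasMultiplicativeReductionAtPrime ℓ₁ ∧ W.HasMultiplicativeReductionAtPrime ℓ₂) →
      ¬ p ∣ W.tamagawaProduct → W.analyticRank = 1 →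
      IsImaginaryQuadratic K → Odd (NumberField.discr K) →
      SatisfiesHeegnerHypothesis (W.conductorNorm ℤ) K →
      (W.quadraticTwist (NumberField.discr K : ℚ)).entireLFunction 1 ≠ 0 →
      (4 * (W.conductorNorm ℤ : ℤ)) ∣ β ^ 2 - NumberField.discr K → ¬ (p : ℤ) ∣ Dt.c →
      ∃ s : ℕ, Odd s ∧ Nat.card (WeierstrassCurve.selmerGroup (W.baseChange K) (p : ℤ)) = p ^ s) ∧
    (∀ (W : WeierstrassCurve ℚ) [W.IsElliptic] [W.IsGloballyMinimal] [NeZero (W.conductorNorm ℤ)]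
      (p : ℕ) [Fact p.Prime] (K : Type) [Field K] [NumberField K]
      (Dt : ModularParametrizationData W (W.conductorNorm ℤ)) (β : ℤ) (ι : K →+* ℂ),
      5 ≤ p → Addv W p → W.HasSurjectiveModNGaloisRep p →
      (∀ (ℓ : ℕ) [Fact ℓ.Prime], W.HasMultiplicativeReductionAtPrime ℓ →
        ¬ p ∣ padicValInt ℓ W.minimalDiscriminantInt) →
      (∃ (ℓ₁ ℓ₂ : ℕ) (_ : Fact ℓ₁.Prime) (_ : Fact ℓ₂.Prime), ℓ₁ ≠ ℓ₂ ∧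
        W.HasMultiplicativeReductionAtPrime ℓ₁ ∧ W.HasMultiplicativeReductionAtPrime ℓ₂) →
      ¬ p ∣ W.tamagawaProduct → W.analyticRank = 1 →
      IsImaginaryQuadratic K → Odd (NumberField.discr K) → NumberField.discr K < -4 →
      SatisfiesHeegnerHypothesis (W.conductorNorm ℤ) K →
      (W.quadraticTwist (NumberField.discr K : ℚ)).entireLFunction 1 ≠ 0 →
      (4 * (W.conductorNorm ℤ : ℤ)) ∣ β ^ 2 - NumberField.discr K → ¬ (p : ℤ) ∣ Dt.c →
      Nat.card (WeierstrassCurve.selmerGroup (W.baseChange K) (p : ℤ)) = p →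
      ∃ d₁ : KolyvaginHeegnerData Dt β ι 1, d₁.kolyvaginClass (Fact.out : p.Prime) 1 ≠ 0) ∧
    (∀ (W : WeierstrassCurve ℚ) [W.IsElliptic] [W.IsGloballyMinimal] [NeZero (W.conductorNorm ℤ)]
      (p : ℕ) [Fact p.Prime] (K : Type) [Field K] [NumberField K]
      (Dt : ModularParametrizationData W (W.conductorNorm ℤ)) (β : ℤ) (ι : K →+* ℂ),
      5 ≤ p → Addv W p → W.HasSurjectiveModNGaloisRep p →
      (∀ (ℓ : ℕ) [Fact ℓ.Prime], W.HasMultiplicativeReductionAtPrime ℓ →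
        ¬ p ∣ padicValInt ℓ W.minimalDiscriminantInt) →
      (∃ (ℓ₁ ℓ₂ : ℕ) (_ : Fact ℓ₁.Prime) (_ : Fact ℓ₂.Prime), ℓ₁ ≠ ℓ₂ ∧
        W.HasMultiplicativeReductionAtPrime ℓ₁ ∧ W.HasMultiplicativeReductionAtPrime ℓ₂) →
      ¬ p ∣ W.tamagawaProduct → W.analyticRank = 1 →
      IsImaginaryQuadratic K → Odd (NumberField.discr K) → NumberField.discr K < -4 →
      SatisfiesHeegnerHypothesis (W.conductorNorm ℤ) K →
      (W.quadraticTwist (NumberField.discr K : ℚ)).entireLFunction 1 ≠ 0 →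
      (4 * (W.conductorNorm ℤ : ℤ)) ∣ β ^ 2 - NumberField.discr K → ¬ (p : ℤ) ∣ Dt.c →
      ∀ s : ℕ, Odd s → 3 ≤ s →
      Nat.card (WeierstrassCurve.selmerGroup (W.baseChange K) (p : ℤ)) = p ^ s →
      (∀ d₁ : KolyvaginHeegnerData Dt β ι 1, d₁.kolyvaginClass (Fact.out : p.Prime) 1 = 0) →
      ∃ (n : ℕ) (d : KolyvaginHeegnerData Dt β ι n),
        KolyvaginDescent.KolSupp (Zhang2014.IsKolyvaginPrime (W.conductorNorm ℤ) W K p) n ∧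
          d.kolyvaginClass (Fact.out : p.Prime) 1 ≠ 0)) :=
  ⟨rankSplit_of_kolyvaginPrimitiveAdditive_of_published hPub hCT,
    fun h ↦ kolyvaginPrimitiveAdditive_of_rankSplit h.1 h.2.1 h.2.2⟩

end Summit.BirchSwinnertonDyer.BirchSwinnertonDyer.Theorems.AdditiveKoly

end
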